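import Mathlib

/-!
# Joint eigenbasis of a commuting family of compact self-adjoint operators

Twenty-first layer of the `provefact` decomposition of `Literature.NumberTheory.Automorphic.sl2BallCount_asymp`
(`Literature/NumberTheory/Automorphic/HyperbolicLatticeCount.lean`): the abstract Hilbert-space
input for the *discrete part* of the spectral theorem for `L²(SL₂(ℤ)\ℍ)` (Iwaniec, *Spectral
Methods of Automorphic Forms*, Thm 4.7: "The automorphic Laplace operator has pure point spectrum
on `𝒞(Γ\ℍ)` ... a complete orthonormal system of cusp forms can be chosen"; there the compact
self-adjoint operators are the invariant integral operators restricted to cusp forms, which commute).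
Everything here is proved from Mathlib's spectral theorem for a single compact self-adjoint
operator (`ContinuousLinearMap.orthogonalComplement_iSup_eigenspaces_eq_bot`,
`ContinuousLinearMap.finite_dimensional_eigenspace`) and the simultaneous diagonalisation of
commuting symmetric operators in finite dimension (`LinearMap.IsSymmetric.iSup_iInf_eq_top_of_commute`).

* `jointEigenspace T α = ⨅ i, eigenspace (T i) (α i)` for a family `T : ι → E →L[𝕜] E`.
* `orthogonal_iSup_jointEigenspace_eq_bot`: for pairwise commuting compact self-adjoint `T i` on a
  Hilbert space, `(⨆ α, jointEigenspace T α)ᗮ = ⊥` (the joint eigenvectors span densely; the joint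
  kernel is the joint eigenspace `α = 0`, no hypothesis on it is needed).
* `exists_orthonormal_dense_jointEigenvectors`: an orthonormal set with dense span consisting of
  simultaneous eigenvectors (Hilbert bases of the joint eigenspaces glued by
  `LinearMap.IsSymmetric.orthogonalFamily_iInf_eigenspaces`).
* `conj_eq_of_jointEigenspace_ne_bot`: the eigenvalue patterns that occur are real
  (stated for symmetric operators, so that no completeness is needed).
* `Orthonormal.countable_of_separableSpace`: orthonormal sets in a separable space are countable.

These are textbook facts (e.g. the simultaneous diagonalisation of commuting compact normal
operators); neither was in Mathlib or Literature
(`lean search 'jointEigenspace|simultaneous.*compact|commuting.*IsCompactOperator'`).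
-/

noncomputable section

namespace Literature.Analysis.OperatorTheory

namespace JointSpectral

open Module Module.End Submodule Filter Topology
open scoped InnerProductSpace

variable {𝕜 E : Type*} [RCLike 𝕜] [NormedAddCommGroup E] [InnerProductSpace 𝕜 E]
variable {ι : Type*} (T : ι → E →L[𝕜] E)

local notation "⟪" x ", " y "⟫" => @inner 𝕜 _ _ x y

/-- The joint eigenspace of the family `T` for the eigenvalue pattern `α : ι → 𝕜`:
`J_α = ⋂_i ker (T_i - α_i)`. [folklore] -/
abbrev jointEigenspace (α : ι → 𝕜) : Submodule 𝕜 E := ⨅ i, eigenspace (T i : End 𝕜 E) (α i)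

/-- Membership: `v ∈ J_α ↔ ∀ i, T_i v = α_i v`. [folklore] -/
theorem mem_jointEigenspace_iff {α : ι → 𝕜} {v : E} :
    v ∈ jointEigenspace T α ↔ ∀ i, T i v = α i • v := by
  simp [jointEigenspace, Submodule.mem_iInf]

/-- A commuting family preserves its joint eigenspaces. [folklore] -/
theorem apply_mem_jointEigenspace (hcomm : ∀ i j, Commute (T i) (T j)) (α : ι → 𝕜) (j : ι)
    {v : E} (hv : v ∈ jointEigenspace T α) : T j v ∈ jointEigenspace T α := by
  rw [mem_jointEigenspace_iff] at hv ⊢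
  intro i
  have h := congrArg (fun f : E →L[𝕜] E => f v) (hcomm i j)
  simp only [ContinuousLinearMap.mul_def, ContinuousLinearMap.comp_apply] at h
  rw [h, hv i, ContinuousLinearMap.map_smul]

/-- ... hence preserves their sup. [folklore] -/
theorem apply_mem_iSup_jointEigenspace (hcomm : ∀ i j, Commute (T i) (T j)) (j : ι)
    {v : E} (hv : v ∈ ⨆ α, jointEigenspace T α) : T j v ∈ ⨆ α, jointEigenspace T α := by
  refine Submodule.iSup_induction _ hv (motive := fun v => T j v ∈ ⨆ α, jointEigenspace T α)
    (fun α x hx => ?_) (by simp) (fun a b ha hb => by rw [map_add]; exact add_mem ha hb)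
  exact le_iSup (jointEigenspace T) α (apply_mem_jointEigenspace T hcomm α j hx)

variable [CompleteSpace E]

/-- **The joint eigenspaces of a commuting family of compact self-adjoint operators have trivial
orthogonal complement** (spectral theorem, discrete part, in the form needed for Maass forms):
`(⨆_α J_α)ᗮ = ⊥`. Proof: `W = ⨆ J_α` is invariant, so is `Wᗮ`; on `Wᗮ` each restricted `T_i` is
compact self-adjoint; if one of them had a non-zero eigenvalue, its (finite-dimensional, invariant)
eigenspace would contain a joint eigenvector of the whole family by simultaneous diagonalisation
in finite dimension — a non-zero vector of `W ∩ Wᗮ`. So all restrictions vanish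
(`eq_zero_of_forall_hasEigenvalue_eq_zero`), i.e. `Wᗮ ⊆ J_0 ⊆ W`, whence `Wᗮ = 0`. [folklore] -/
theorem orthogonal_iSup_jointEigenspace_eq_bot (hsa : ∀ i, IsSelfAdjoint (T i))
    (hc : ∀ i, IsCompactOperator (T i)) (hcomm : ∀ i j, Commute (T i) (T j)) :
    (⨆ α : ι → 𝕜, jointEigenspace T α)ᗮ = ⊥ := by
  set W : Submodule 𝕜 E := ⨆ α : ι → 𝕜, jointEigenspace T α with hW
  have hWinv : ∀ j, ∀ v ∈ Wᗮ, T j v ∈ Wᗮ := fun j v hv => by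
    have h := (hsa j).isSymmetric.orthogonalComplement_mem_invtSubmodule
      ((Module.End.mem_invtSubmodule_iff_forall_mem_of_mem _).mpr
        fun u hu => apply_mem_iSup_jointEigenspace T hcomm j hu)
    exact h hv
  -- restrictions to `Wᗮ`
  set S : ι → Wᗮ →L[𝕜] Wᗮ := fun j => (T j).restrict (hWinv j) with hS
  have hSc : ∀ j, IsCompactOperator (S j) := fun j => (hc j).restrict' (hWinv j)
  have hSsym : ∀ j, (S j : Wᗮ →ₗ[𝕜] Wᗮ).IsSymmetric := fun j =>
    (hsa j).isSymmetric.restrict_invariant (hWinv j)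
  have hSapply : ∀ j (v : Wᗮ), ((S j v : Wᗮ) : E) = T j (v : E) := fun j v => rfl
  have hScomm : ∀ i j (v : Wᗮ), S i (S j v) = S j (S i v) := by
    intro i j v
    apply Subtype.ext
    rw [hSapply, hSapply, hSapply, hSapply]
    have h := congrArg (fun f : E →L[𝕜] E => f (v : E)) (hcomm i j)
    simpa only [ContinuousLinearMap.mul_def, ContinuousLinearMap.comp_apply] using h
  -- every restriction vanishes
  have hS0 : ∀ j, S j = 0 := by
    intro j
    rw [← ContinuousLinearMap.eq_zero_of_forall_hasEigenvalue_eq_zero (hSc j) (hSsym j)]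
    intro μ hμ
    by_contra hμ0
    -- the `μ`-eigenspace of `T j` inside `Wᗮ`, as a subspace of `E`: finite-dimensional, non-zero,
    -- invariant under the whole family
    haveI : FiniteDimensional 𝕜 (eigenspace (T j).toLinearMap μ) :=
      ContinuousLinearMap.finite_dimensional_eigenspace (hc j) μ hμ0
    set V : Submodule 𝕜 E := Wᗮ ⊓ eigenspace (T j).toLinearMap μ with hV
    haveI : FiniteDimensional 𝕜 V := Submodule.finiteDimensional_inf_right _ _
    have hVinv : ∀ i, ∀ v ∈ V, T i v ∈ V := by
      intro i v hv
      rw [hV, Submodule.mem_inf, mem_eigenspace_iff] at hv ⊢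
      refine ⟨hWinv i v hv.1, ?_⟩
      change T j (T i v) = μ • T i v
      have h := congrArg (fun f : E →L[𝕜] E => f v) (hcomm j i)
      simp only [ContinuousLinearMap.mul_def, ContinuousLinearMap.comp_apply] at h
      rw [h, show (T j) v = μ • v from hv.2, ContinuousLinearMap.map_smul]
    let R : ι → V →ₗ[𝕜] V := fun i => ((T i : E →ₗ[𝕜] E)).restrict (hVinv i)
    have hRapply : ∀ i (v : V), ((R i v : V) : E) = T i (v : E) := fun i v => rfl
    have hRsym : ∀ i, (R i).IsSymmetric := fun i => (hsa i).isSymmetric.restrict_invariant (hVinv i)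
    have hRcomm : Pairwise (Function.onFun Commute R) := by
      intro i i' _
      ext v
      change (((R i) ((R i') v) : V) : E) = (((R i') ((R i) v) : V) : E)
      rw [hRapply, hRapply, hRapply, hRapply]
      have h := congrArg (fun f : E →L[𝕜] E => f (v : E)) (hcomm i i')
      simpa only [ContinuousLinearMap.mul_def, ContinuousLinearMap.comp_apply] using h
    have htop := LinearMap.IsSymmetric.iSup_iInf_eq_top_of_commute hRsym hRcomm
    -- `V ≠ 0`, so some joint eigenspace of the `R i` is non-zero
    have hVne : (⊤ : Submodule 𝕜 V) ≠ ⊥ := by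
      obtain ⟨x, hx, hx0⟩ := Submodule.exists_mem_ne_zero_of_ne_bot (hasEigenvalue_iff.mp hμ)
      have hxV : (x : E) ∈ V := by
        rw [hV, Submodule.mem_inf, mem_eigenspace_iff]
        refine ⟨x.2, ?_⟩
        have h1 : (S j) x = μ • x := mem_eigenspace_iff.mp hx
        have h2 := congrArg (fun y : Wᗮ => (y : E)) h1
        simp only [hSapply, Submodule.coe_smul] at h2
        exact h2
      intro h
      have : (⟨(x : E), hxV⟩ : V) ∈ (⊤ : Submodule 𝕜 V) := Submodule.mem_top
      rw [h, Submodule.mem_bot] at this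
      exact hx0 (Subtype.ext (congrArg Subtype.val this : ((⟨(x : E), hxV⟩ : V) : E) = ((0 : V) : E)))
    rw [← htop] at hVne
    obtain ⟨χ, hχ⟩ : ∃ χ : ι → 𝕜, (⨅ i, eigenspace (R i) (χ i)) ≠ ⊥ := by
      by_contra h
      push Not at h
      apply hVne
      simp [h]
    obtain ⟨v, hv, hv0⟩ := Submodule.exists_mem_ne_zero_of_ne_bot hχ
    -- `v` is a joint eigenvector of the whole family
    have hx : ∀ i, T i (v : E) = χ i • (v : E) := by
      intro i
      have h1 : R i v = χ i • v := mem_eigenspace_iff.mp ((Submodule.mem_iInf _).mp hv i)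
      have h2 := congrArg (fun y : V => (y : E)) h1
      simpa only [hRapply, Submodule.coe_smul] using h2
    have hxW : (v : E) ∈ W := le_iSup (jointEigenspace T) χ ((mem_jointEigenspace_iff T).mpr hx)
    have hxWo : (v : E) ∈ Wᗮ := (Submodule.mem_inf.mp v.2).1
    have h0 : (v : E) = 0 := by
      have : (v : E) ∈ W ⊓ Wᗮ := Submodule.mem_inf.mpr ⟨hxW, hxWo⟩
      rwa [Submodule.inf_orthogonal_eq_bot, Submodule.mem_bot] at this
    exact hv0 (Subtype.ext h0)
  -- conclude
  rw [Submodule.eq_bot_iff]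
  intro v hv
  have h0 : ∀ j, T j v = 0 := by
    intro j
    have h := congrArg (fun f : Wᗮ →L[𝕜] Wᗮ => ((f ⟨v, hv⟩ : Wᗮ) : E)) (hS0 j)
    rw [hSapply] at h
    simpa using h
  have hvW : v ∈ W := le_iSup (jointEigenspace T) 0
    ((mem_jointEigenspace_iff T).mpr fun i => by rw [h0 i, Pi.zero_apply, zero_smul])
  have : v ∈ W ⊓ Wᗮ := Submodule.mem_inf.mpr ⟨hvW, hv⟩
  rwa [Submodule.inf_orthogonal_eq_bot, Submodule.mem_bot] at this

omit [CompleteSpace E] in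
/-- Joint eigenspaces are closed. [folklore] -/
theorem isClosed_jointEigenspace (α : ι → 𝕜) : IsClosed ((jointEigenspace T α : Submodule 𝕜 E) : Set E) := by
  have e : ((jointEigenspace T α : Submodule 𝕜 E) : Set E) = ⋂ i, {v : E | T i v = α i • v} := by
    ext v
    simp only [SetLike.mem_coe, Set.mem_iInter, Set.mem_setOf_eq]
    exact mem_jointEigenspace_iff T
  rw [e]
  exact isClosed_iInter fun i => isClosed_eq (T i).continuous (continuous_const_smul (α i))

/-- **Existence of a complete orthonormal system of joint eigenvectors** for a commuting family
of compact self-adjoint operators on a Hilbert space: an orthonormal set `s` with dense span each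
of whose members is a simultaneous eigenvector of all `T_i` (assembled from orthonormal bases of
the joint eigenspaces). [folklore] -/
theorem exists_orthonormal_dense_jointEigenvectors (hsa : ∀ i, IsSelfAdjoint (T i))
    (hc : ∀ i, IsCompactOperator (T i)) (hcomm : ∀ i j, Commute (T i) (T j)) :
    ∃ s : Set E, Orthonormal 𝕜 ((↑) : s → E) ∧ ⊤ ≤ (span 𝕜 s).topologicalClosure ∧
      ∀ x ∈ s, ∃ α : ι → 𝕜, x ∈ jointEigenspace T α := by
  classical
  -- a Hilbert basis of each joint eigenspace
  have hJ : ∀ α : ι → 𝕜, ∃ (w : Set (jointEigenspace T α)) (b : HilbertBasis w 𝕜 (jointEigenspace T α)),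
      ⇑b = ((↑) : w → jointEigenspace T α) := by
    intro α
    haveI : CompleteSpace (jointEigenspace T α) := (isClosed_jointEigenspace T α).completeSpace_coe
    exact exists_hilbertBasis 𝕜 (jointEigenspace T α)
  choose w b hb using hJ
  set v : (Σ α : ι → 𝕜, w α) → E := fun p => ((b p.1 p.2 : jointEigenspace T p.1) : E) with hv
  have hmem : ∀ p : Σ α : ι → 𝕜, w α, v p ∈ jointEigenspace T p.1 := fun p => (b p.1 p.2).2
  have horth : ∀ {α α' : ι → 𝕜}, α ≠ α' → ∀ x ∈ jointEigenspace T α, ∀ y ∈ jointEigenspace T α', ⟪x, y⟫ = 0 := by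
    intro α α' hne x hx y hy
    have H := LinearMap.IsSymmetric.orthogonalFamily_iInf_eigenspaces
      (T := fun i => (T i : End 𝕜 E)) (fun i => (hsa i).isSymmetric) hne
    exact H ⟨x, hx⟩ ⟨y, hy⟩
  have hvo : Orthonormal 𝕜 v := by
    rw [orthonormal_iff_ite]
    rintro ⟨α, x⟩ ⟨α', x'⟩
    by_cases hαα : α = α'
    · subst hαα
      have h := (b α).orthonormal
      rw [orthonormal_iff_ite] at h
      simp only [hv]
      rw [← Submodule.coe_inner, h x x']
      by_cases hxx : x = x'
      · subst hxx; simp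
      · rw [if_neg hxx, if_neg]
        intro heq
        exact hxx (eq_of_heq (Sigma.mk.inj heq).2)
    · rw [if_neg (fun heq => hαα (Sigma.mk.inj heq).1)]
      exact horth hαα _ (hmem ⟨α, x⟩) _ (hmem ⟨α', x'⟩)
  -- dense span
  have hsp : ⊤ ≤ (span 𝕜 (Set.range v)).topologicalClosure := by
    rw [top_le_iff, Submodule.topologicalClosure_eq_top_iff, Submodule.eq_bot_iff]
    intro y hy
    rw [Submodule.mem_orthogonal] at hy
    -- `y ⊥ J_α` for every `α`
    have hyJ : ∀ α, ∀ x ∈ jointEigenspace T α, ⟪x, y⟫ = 0 := by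
      intro α x hx
      haveI : CompleteSpace (jointEigenspace T α) := (isClosed_jointEigenspace T α).completeSpace_coe
      -- on the span of the Hilbert basis `b α`
      set K : Submodule 𝕜 (jointEigenspace T α) := span 𝕜 (Set.range (b α)) with hK
      have hK0 : ∀ z ∈ K, ⟪((z : jointEigenspace T α) : E), y⟫ = 0 := by
        intro z hz
        refine Submodule.span_induction (p := fun z _ => ⟪((z : jointEigenspace T α) : E), y⟫ = 0)
          ?_ ?_ ?_ ?_ hz
        · rintro _ ⟨i, rfl⟩
          exact hy _ (subset_span ⟨⟨α, i⟩, rfl⟩)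
        · simp
        · intro a c _ _ ha hc
          rw [Submodule.coe_add, inner_add_left, ha, hc, add_zero]
        · intro c z _ hz
          rw [Submodule.coe_smul, inner_smul_left, hz, mul_zero]
      -- by density and continuity
      have hcl : IsClosed {z : jointEigenspace T α | ⟪((z : jointEigenspace T α) : E), y⟫ = 0} :=
        isClosed_eq (continuous_subtype_val.inner continuous_const) continuous_const
      have hdense : (K.topologicalClosure : Set (jointEigenspace T α)) = Set.univ := by
        rw [hK, (b α).dense_span]; rfl
      have hsub : (K.topologicalClosure : Set (jointEigenspace T α)) ⊆
          {z : jointEigenspace T α | ⟪((z : jointEigenspace T α) : E), y⟫ = 0} := by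
        rw [Submodule.topologicalClosure_coe]
        exact closure_minimal hK0 hcl
      have := hsub (hdense ▸ Set.mem_univ (⟨x, hx⟩ : jointEigenspace T α))
      simpa using this
    have hyW : y ∈ (⨆ α : ι → 𝕜, jointEigenspace T α)ᗮ := by
      rw [Submodule.mem_orthogonal]
      intro u hu
      exact Submodule.iSup_induction _ hu (motive := fun u => ⟪u, y⟫ = 0) (fun α x hx => hyJ α x hx)
        (by simp) (fun a c ha hc => by rw [inner_add_left, ha, hc, add_zero])
    rw [orthogonal_iSup_jointEigenspace_eq_bot T hsa hc hcomm, Submodule.mem_bot] at hyW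
    exact hyW
  refine ⟨Set.range v, hvo.toSubtypeRange, hsp, ?_⟩
  rintro x ⟨p, rfl⟩
  exact ⟨p.1, hmem p⟩

omit [CompleteSpace E] in
/-- The eigenvalue pattern of a non-zero joint eigenspace of symmetric operators is real
(for self-adjoint `T i` use `(hsa i).isSymmetric`). [folklore] -/
theorem conj_eq_of_jointEigenspace_ne_bot (hsa : ∀ i, (T i : E →ₗ[𝕜] E).IsSymmetric) {α : ι → 𝕜}
    (hα : jointEigenspace T α ≠ ⊥) (i : ι) : (starRingEnd 𝕜) (α i) = α i := by
  obtain ⟨v, hv, hv0⟩ := Submodule.exists_mem_ne_zero_of_ne_bot hα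
  have hvi : v ∈ eigenspace (T i : End 𝕜 E) (α i) := (Submodule.mem_iInf _).mp hv i
  have hev : HasEigenvalue (T i : End 𝕜 E) (α i) := by
    rw [hasEigenvalue_iff]
    intro h
    rw [h, Submodule.mem_bot] at hvi
    exact hv0 hvi
  exact (hsa i).conj_eigenvalue_eq_self hev

omit [CompleteSpace E] T in
/-- **Orthonormal sets in a separable inner product space are countable** (distinct members are
at distance `√2`; map each to a nearby point of a countable dense set). [folklore] -/
theorem _root_.Orthonormal.countable_of_separableSpace [TopologicalSpace.SeparableSpace E]
    {s : Set E} (hs : Orthonormal 𝕜 ((↑) : s → E)) : s.Countable := by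
  obtain ⟨D, hDc, hDd⟩ := TopologicalSpace.exists_countable_dense E
  -- distinct elements of `s` are at distance `√2 > 1`
  have hdist : ∀ x ∈ s, ∀ y ∈ s, x ≠ y → 1 < dist x y := by
    intro x hx y hy hxy
    have h1 : ‖x‖ = 1 := hs.1 ⟨x, hx⟩
    have h2 : ‖y‖ = 1 := hs.1 ⟨y, hy⟩
    have h3 : ⟪x, y⟫ = 0 := hs.2 (fun h => hxy (congrArg Subtype.val h) : (⟨x, hx⟩ : s) ≠ ⟨y, hy⟩)
    have h4 : ‖x - y‖ ^ 2 = 2 := by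
      rw [@norm_sub_sq 𝕜, h1, h2, h3]; simp; norm_num
    rw [dist_eq_norm]
    nlinarith [norm_nonneg (x - y)]
  -- send each point of `s` to a point of `D` within distance `1/2`
  have hch : ∀ x : E, ∃ d ∈ D, dist x d < 1 / 2 := fun x => hDd.exists_dist_lt x (by norm_num)
  choose d hdD hdd using hch
  have hinj : Set.InjOn d s := by
    intro x hx y hy hxy
    by_contra hne
    have h := hdist x hx y hy hne
    have h' : dist x y < 1 := by
      calc dist x y ≤ dist x (d x) + dist (d x) y := dist_triangle _ _ _
        _ = dist x (d x) + dist y (d y) := by rw [hxy, dist_comm (d y) y]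
        _ < 1 / 2 + 1 / 2 := add_lt_add (hdd x) (hdd y)
        _ = 1 := by norm_num
    linarith
  exact Set.countable_of_injective_of_countable_image hinj (hDc.mono (by rintro _ ⟨x, _, rfl⟩; exact hdD x))

end JointSpectral

end Literature.Analysis.OperatorTheory
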